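import Mathlib
import Summits.Ventures.HodgeRepro.Tier4.Common.Automorphic
import Summits.Ventures.HodgeRepro.Tier4.Common.ConcreteCocompact
import Summits.Ventures.HodgeRepro.Tier4.Line1.RTFSetting
import Summits.Ventures.HodgeRepro.Tier4.Line1.DefinedContentOfData

/-!
# Tier4/Line1/RTFSide — the automorphic side of LINE L1 INSTANTIATED BY THE RELATIVE TRACE FORMULA: the face's
`Tau` = the invariant subspaces of `L²([U(W)])`, its toric periods = the RTF's toric functionals (the pins `pinT`,
`pinT′` of the costume become DEFINITIONAL), and the assembly `(P)` ⟸ RTF output ∧ lift ∧ seesaw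

Blind re-derivation cell `pub-hodge-repro`, Tier 4 (README §9–§10), seat t4-L1-p3 (gen 2).  Target tree path
`lean/Summits/Ventures/HodgeRepro/Tier4/Line1/RTFSide.lean`.  Imports typer-2's `Common.Automorphic`
(`ThetaLifts`, `EndoscopicSide`, `toC7Face`, `toC7Face_P`; through it night-2's `C7Face`, `SpectralInterface`,
`SeesawComponents`, `P_of_P'_of_components`), typer-1's `Common.ConcreteCocompact` (`TargetData.IsLevel`,
`IsCocompact`, `concreteWitness`, `conclusion_of_concrete_P_cocompact`), LINE L1's `RTFSetting` and this seat's
`DefinedContentOfData` (`exists_periods_of_isolation`).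

WHAT THIS IS.  The costume `line1_realise` (Skeleton v0.31 L1226) owes, beyond the DEFINED RTF content, the FREE
half: the pins `pinT` / `pinT′` («the defined `χ`-functional on `τ m` IS the face's toric period on `tau m`»), the
lift `F1 + F2` and the seesaw components (S1)–(S3).  The skeleton's docstring says the pins are «definitional once
`side.Tau` is instantiated by the invariant subspaces» — this file does exactly that:
* `sideWithRTFSpectrum E₀ S χ χ′ τ tl Lift` — the side `E₀` with `Tau := ℕ` (the index of the adapted
  family's invariant subspaces `τ m ⊆ L²(DG)`), `toricPeriodNonzero 0 _ m := S.PeriodNonzeroT χ (τ m)`,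
  `toricPeriodNonzero 1 _ m := S.PeriodNonzeroT′ χ′ (τ m)` (the characters do not depend on the choice of translates:
  Hecke translates keep the character), `liftNonzero := Lift` (the `(2,0)`-lift clause, FREE), `thetaLiftTau := tl`;
  every other field of `E₀` unchanged.  On it the pins hold by `rfl` (`toricPeriodNonzero_withRTFSpectrum_zero/one`).
* `P'_withRTFSpectrum` — (P′) of the instantiated face from one `m` with both functionals and `Lift m`.
* `P_of_rtf_inputs` — **(P) for the witness** from: the DEFINED RTF content as INPUTS (characters, an adapted family,
  an isolating pair with a non-zero orbital term — `exists_defined_content_ofData` supplies one), the lift hypothesis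
  `hlift : ∀ m, PeriodNonzeroT χ (τ m) → PeriodNonzeroT′ χ′ (τ m) → Hit (cj f₁) (τ m) → Lift m` for THAT `f₁`
  (F1 + F2: Rallis inner product at the edge + local non-vanishing, on the admissible types `f₁` selects — F2′), and
  the seesaw components (S1)–(S3) on the instantiated face (the theta-correspondence content: the Hodge pairing as a
  finite sum over the `τ m` of `τ`-terms, a non-zero term forcing the atoms, isolation of a term).
* `conclusion_of_rtf_inputs` — **the conclusion of `P_T4` for a datum `d`** from the same inputs on
  typer-1's concrete witness at a cocompact level `Γ′` (`conclusion_of_concrete_P_cocompact`).  This is the costume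
  `line1_realise d` with its free half DISPLAYED, binder by binder, and nothing hidden: `Γ′`, `hΓ′`, the printed
  `hcc`, `Θ`, a side `E₀`, the base choice `base`, the RTF datum and its DEFINED content, `Lift`, `hlift`, `hseesaw`.
WHY the lift hypothesis is stated for the GIVEN `f₁` and not for every isolating pair: the `(2,0)`-lift of a `τ`
with both toric periods is non-zero only for `τ` of admissible local type at the places of `S`, which the costume
enforces by the admissible projector `e_S` in `f₁` (F2′); a hypothesis universal over all isolating `f₁` would be
false on the intended instance.  Nothing here says anything about the status of the Hodge conjecture for CM abelian
varieties, which is NOT proved (HC_CM is NOT proved by anyone in this repository).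
-/

set_option autoImplicit false

noncomputable section

namespace Summit.Ventures.HodgeRepro.Tier4.Line1

open NumberField Common PeriodCloser MeasureTheory

section Side

variable {L : Type} [Field L] [NumberField L] [IsCMField L]
  {Form : Type} [AddCommGroup Form] [Module ℂ Form] {A : FormAlgebra Form} {W : Witness A}
  {Θ : ThetaLifts W} (E₀ : EndoscopicSide L W Θ)
  {G : Type} [Group G] [TopologicalSpace G] [MeasurableSpace G]
  (S : RTF.Setting G) (χ : S.T → ℂ) (χ' : S.T' → ℂ) (τ : ℕ → Set (G → ℂ)) (tl : Θ.U1Char → ℕ) (Lift : ℕ → Prop)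

/-- **The endoscopic side instantiated by the RTF spectrum**: `Tau := ℕ` indexes the invariant subspaces `τ m`, the
toric periods are the RTF's toric functionals `PeriodNonzeroT χ (τ m)` / `PeriodNonzeroT′ χ′ (τ m)` (independent
of the choice of translates), the lift clause is the FREE `Lift`, `thetaLiftTau := tl`; every other field of `E₀` is
kept. -/
def sideWithRTFSpectrum : EndoscopicSide L W Θ :=
  { E₀ with
    Tau := ℕ
    thetaLiftTau := tl
    toricPeriodNonzero := ![fun _ m => S.PeriodNonzeroT χ (τ m), fun _ m => S.PeriodNonzeroT' χ' (τ m)]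
    liftNonzero := Lift }

/-- The pin `pinT` is definitional: the face's first toric period on `m` IS the RTF's `χ`-functional on `τ m`. -/
theorem toricPeriodNonzero_withRTFSpectrum_zero (γ : W.Translates) (m : ℕ) :
    (sideWithRTFSpectrum E₀ S χ χ' τ tl Lift).toC7Face.toricPeriodNonzero 0 γ m ↔ S.PeriodNonzeroT χ (τ m) :=
  Iff.rfl

/-- The pin `pinT′` is definitional: the face's second toric period on `m` IS the RTF's `χ′`-functional on `τ m`. -/
theorem toricPeriodNonzero_withRTFSpectrum_one (γ : W.Translates) (m : ℕ) :
    (sideWithRTFSpectrum E₀ S χ χ' τ tl Lift).toC7Face.toricPeriodNonzero 1 γ m ↔ S.PeriodNonzeroT' χ' (τ m) :=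
  Iff.rfl

/-- The lift clause of the instantiated face is `Lift`. -/
theorem liftNonzero_withRTFSpectrum (m : ℕ) :
    (sideWithRTFSpectrum E₀ S χ χ' τ tl Lift).toC7Face.liftNonzero m ↔ Lift m :=
  Iff.rfl

/-- The datum of the instantiated face is still a choice of translates. -/
theorem toC7Face_withRTFSpectrum_Datum :
    (sideWithRTFSpectrum E₀ S χ χ' τ tl Lift).toC7Face.Datum = W.Translates := rfl

/-- **(P′) of the instantiated face** from one index `m` carrying both toric functionals and the lift clause. -/
theorem P'_withRTFSpectrum (base : W.Translates) (m : ℕ) (hT : S.PeriodNonzeroT χ (τ m))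
    (hT' : S.PeriodNonzeroT' χ' (τ m)) (hL : Lift m) :
    (sideWithRTFSpectrum E₀ S χ χ' τ tl Lift).toC7Face.P' := by
  refine ⟨base, m, ?_, hL⟩
  intro i
  fin_cases i
  · exact hT
  · exact hT'

/-- **(P) for the witness from the RTF inputs, the lift hypothesis and the seesaw components** — the assembly of
LINE L1 with every free input displayed: the DEFINED content (characters `χ`, `χ′`, an adapted family `(τ, φ, n)`,
an isolating pair `(f₁, f₂)` with one rational double coset `o₀` and a non-zero orbital term) produces, through
`exists_periods_of_isolation` (L1.1 + L1.2b + L1.5), an `m` with both toric functionals on `τ m` hit by `f̄₁`; the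
lift hypothesis gives `Lift m`; (P′) of the instantiated face follows definitionally; night-2's
`P_of_P'_of_components` with the seesaw components gives (P) of the face, which is `W.P` by `toC7Face_P`. -/
theorem P_of_rtf_inputs [IsTopologicalGroup G] [BorelSpace G] (hχ : S.IsCharacter χ) (hχ' : S.IsCharacter' χ')
    {φ : ℕ → G → ℂ} {n : ℕ → ℕ}
    (hB : S.IsAdaptedONB τ φ n) {f₁ f₂ : G → ℂ} (h₁ : RTF.IsTest f₁) (h₂ : RTF.IsTest f₂)
    (hconv : RTF.IsTest (S.conv f₁ f₂)) {o₀ : S.Orbit} (hiso : S.geoSupport (S.conv f₁ f₂) = {o₀})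
    (hne : S.orbital χ χ' o₀ (S.conv f₁ f₂) ≠ 0) (base : W.Translates)
    (hlift : ∀ m, S.PeriodNonzeroT χ (τ m) → S.PeriodNonzeroT' χ' (τ m) → S.Hit (RTF.cj f₁) (τ m) → Lift m)
    (hseesaw : ∃ Sp : SpectralInterface (sideWithRTFSpectrum E₀ S χ χ' τ tl Lift).toC7Face,
      SeesawComponents (sideWithRTFSpectrum E₀ S χ χ' τ tl Lift).toC7Face Sp) : W.P := by
  obtain ⟨m, hT, hT', hhit⟩ := S.exists_periods_of_isolation hχ hχ' hB h₁ h₂ hconv hiso hne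
  have hP' : (sideWithRTFSpectrum E₀ S χ χ' τ tl Lift).toC7Face.P' :=
    P'_withRTFSpectrum E₀ S χ χ' τ tl Lift base m hT hT' (hlift m hT hT' hhit)
  obtain ⟨Sp, hSp⟩ := hseesaw
  exact (sideWithRTFSpectrum E₀ S χ χ' τ tl Lift).toC7Face_P.mp
    (P_of_P'_of_components (sideWithRTFSpectrum E₀ S χ χ' τ tl Lift).toC7Face Sp hSp hP')

end Side

section Target

variable {F E : Type} [Field F] [NumberField F] [IsGalois ℚ F] [IsCMField F]
  [Field E] [NumberField E] [IsGalois ℚ E] [IsCMField E]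

/-- **The conclusion of `P_T4` for a datum `d` from the RTF inputs** — the costume `line1_realise d` with its free
half DISPLAYED: a cocompact level `Γ′` (`hcc` = the printed Borel–Harish-Chandra input), theta lifts `Θ` and a side
`E₀` on typer-1's concrete witness, a base choice of translates, an RTF setting with characters and the DEFINED
content (an adapted family, an isolating pair with a non-zero orbital term), the lift clause `Lift` with the lift
hypothesis for the given `f₁`, and the seesaw components on the RTF-instantiated face; the conclusion is
`d.conclusion` through `conclusion_of_concrete_P_cocompact`. -/
theorem conclusion_of_rtf_inputs (d : TargetData F E) {Γ' : Set (Matrix (Fin 3) (Fin 3) E)}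
    (hΓ' : d.IsLevel Γ') (hcc : d.IsCocompact Γ')
    {Θ : ThetaLifts (d.concreteWitness hΓ' (isDomain_dom d hΓ').subset_ball (isDomain_dom d hΓ').measurableSet
      (d.residual_of_cocompact hΓ' hcc))}
    (E₀ : EndoscopicSide E (d.concreteWitness hΓ' (isDomain_dom d hΓ').subset_ball
      (isDomain_dom d hΓ').measurableSet (d.residual_of_cocompact hΓ' hcc)) Θ)
    {G : Type} [Group G] [TopologicalSpace G] [IsTopologicalGroup G] [MeasurableSpace G] [BorelSpace G]
    (S : RTF.Setting G) {χ : S.T → ℂ} {χ' : S.T' → ℂ} (hχ : S.IsCharacter χ) (hχ' : S.IsCharacter' χ')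
    {τ : ℕ → Set (G → ℂ)} {φ : ℕ → G → ℂ} {n : ℕ → ℕ} (hB : S.IsAdaptedONB τ φ n) {f₁ f₂ : G → ℂ}
    (h₁ : RTF.IsTest f₁) (h₂ : RTF.IsTest f₂) (hconv : RTF.IsTest (S.conv f₁ f₂)) {o₀ : S.Orbit}
    (hiso : S.geoSupport (S.conv f₁ f₂) = {o₀}) (hne : S.orbital χ χ' o₀ (S.conv f₁ f₂) ≠ 0)
    (tl : Θ.U1Char → ℕ) (Lift : ℕ → Prop)
    (base : (d.concreteWitness hΓ' (isDomain_dom d hΓ').subset_ball (isDomain_dom d hΓ').measurableSet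
      (d.residual_of_cocompact hΓ' hcc)).Translates)
    (hlift : ∀ m, S.PeriodNonzeroT χ (τ m) → S.PeriodNonzeroT' χ' (τ m) → S.Hit (RTF.cj f₁) (τ m) → Lift m)
    (hseesaw : ∃ Sp : SpectralInterface (sideWithRTFSpectrum E₀ S χ χ' τ tl Lift).toC7Face,
      SeesawComponents (sideWithRTFSpectrum E₀ S χ χ' τ tl Lift).toC7Face Sp) : d.conclusion :=
  d.conclusion_of_concrete_P_cocompact hΓ' hcc
    (P_of_rtf_inputs E₀ S χ χ' τ tl Lift hχ hχ' hB h₁ h₂ hconv hiso hne base hlift hseesaw)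

end Target

end Summit.Ventures.HodgeRepro.Tier4.Line1

end
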